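import Summits.CriticalPhenomena.PercolationContinuityZ3.Theorems.PercNecklaceBackboneTruncatedSusceptibilityFiniteOfThetaOfBlocking
import HarnessLib

/-!
# Crux `TruncatedSusceptibilityFiniteOfTheta` (stmt-CriticalPhenomena-0852): `χᶠ < ∞` forces SUMMABLE blocking —
# the crux is the summit modulo non-summable critical annulus blocking

Lead prover-line-stmt-CriticalPhenomena-0852-c3-0 (line `registered`, continuation c3), 2026-08-17. Notation as in
`…TruncatedSusceptibilityFiniteOfThetaOfBlocking.lean`: `u_n(p) = blockProb 3 p n`, `E_n = siteToBoundary 3 n \ percolatesAt 0`,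
`τᶠ_p(0,x) = P_p(0 ↔ x, |C(0)| < ∞)`, `χᶠ(p) = Σ_x τᶠ_p(0,x)`.

* `real_finiteArm_le_sum_sphere`: `P_p(E_n) ≤ Σ_{‖x‖_∞ = n} τᶠ_p(0,x)` (the arm ends on the sphere `∂Λ_n`);
  `sum_range_real_finiteArm_le_sum_box`: `Σ_{n ≤ N} P_p(E_n) ≤ Σ_{x ∈ Λ_N} τᶠ_p(0,x)` (a box is the disjoint union of its spheres);
  `summable_real_finiteArm_of_truncatedSusceptibility`: `χᶠ(p) < ∞ ⇒ Σ_n P_p(E_n) ≤ χᶠ(p) < ∞` (every `p`).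
* `summable_blockProb_of_truncatedSusceptibility` (every `p` with `θ(p) > 0`): `χᶠ(p) < ∞ ⇒ Σ_n u_n(p) < ∞`, by the radius
  quarantine sandwich `u_n θ ≤ P(E_n)`; registered sub-goal `stub_summable_blocking_of_truncatedSusceptibility` = its `p_c` instance.
* CERTIFICATE `TruncatedSusceptibilityFiniteOfTheta_iff_summit_of_not_summable_blocking` (+ home-route spelling):
  **`Σ_n u_n(p_c) = ∞ ⇒ (TruncatedSusceptibilityFiniteOfTheta ↔ PercolationContinuityZ3)`** — the same blocking input that retires
  the registered stub (`criticalRadiusMoment_iff_summit_of_not_summable_blocking`) retires the CRUX: short of `θ(p_c) = 0`, crux 0852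
  can only be proved in a world where critical annulus blocking is summable (numerically `u_n → u_∞ > 0`).
No new definitions; no sorry.
-/

noncomputable section

namespace Summit.CriticalPhenomena.PercolationContinuityZ3.Theorems.TruncatedSusceptibilityFiniteOfTheta

open MeasureTheory ProbabilityTheory Filter Topology
open scoped Classical
open Literature.Probability.Percolation Literature.Probability.LatticeModels
open Literature.Probability.Percolation.DCT16
open Literature.Barriers.CriticalPhenomena (annulusCrossing)
open Summit.CriticalPhenomena.PercolationContinuityZ3.Theorems.SubpolynomialBlocking.Negative
  (blockProb blockProb_nonneg)

/-! ## §1 Arms end on spheres: `Σ_n P(E_n) ≤ χᶠ` -/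

/-- **`P_p(0 ↔ ∂Λ_n, |C(0)| < ∞) ≤ Σ_{‖x‖_∞ = n} τᶠ_p(0,x)`**: the arm's endpoint lies on the sphere `∂Λ_n = ∂ⁱⁿΛ_n` and is
joined to `0`, with `C(0)` finite; union bound over the sphere. [folklore] -/
theorem real_finiteArm_le_sum_sphere (p : unitInterval) (n : ℕ) :
    (bondPercolation (zdGraph 3) p).real (siteToBoundary 3 n \ percolatesAt 0) ≤
      ∑ x ∈ sphere 3 n, (bondPercolation (zdGraph 3) p).real (openConn 0 x \ percolatesAt 0) := by
  set μ := bondPercolation (zdGraph 3) p with hμ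
  have hsub : siteToBoundary 3 n \ percolatesAt 0 ⊆
      ⋃ x ∈ sphere 3 n, (openConn 0 x \ percolatesAt 0 : Set (BondConfig (Site 3))) := by
    rintro ω ⟨⟨y, hy, hpath⟩, hfin⟩
    rw [innerBoundary_box_of (Or.inl (by norm_num : 1 ≤ 3))] at hy
    refine Set.mem_biUnion (Finset.mem_coe.2 hy) ⟨?_, hfin⟩
    exact DCT16.reachable_of_pathIn (pathIn_of_mem_openConnIn hpath)
  calc μ.real (siteToBoundary 3 n \ percolatesAt 0)
      ≤ μ.real (⋃ x ∈ sphere 3 n, (openConn 0 x \ percolatesAt 0 : Set (BondConfig (Site 3)))) :=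
        measureReal_mono hsub (measure_ne_top μ _)
    _ ≤ ∑ x ∈ sphere 3 n, μ.real (openConn 0 x \ percolatesAt 0) := measureReal_biUnion_finset_le _ _

/-- A box is the disjoint union of its spheres: `Σ_{x ∈ Λ_N} f(x) = Σ_{m ≤ N} Σ_{‖x‖_∞ = m} f(x)`. [folklore] -/
theorem sum_box_eq_sum_range_sum_sphere (f : Site 3 → ℝ) (N : ℕ) :
    ∑ x ∈ box 3 N, f x = ∑ m ∈ Finset.range (N + 1), ∑ x ∈ sphere 3 m, f x := by
  rw [← Finset.sum_fiberwise_of_maps_to (g := Site.supNorm) (t := Finset.range (N + 1))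
    (fun x hx => Finset.mem_range.2 (Nat.lt_succ_of_le (mem_box_iff_supNorm_le.1 hx)))]
  refine Finset.sum_congr rfl fun m hm => Finset.sum_congr ?_ fun _ _ => rfl
  ext x
  simp only [Finset.mem_filter, mem_box_iff_supNorm_le, mem_sphere]
  constructor
  · rintro ⟨-, h⟩; exact h
  · intro h; exact ⟨by rw [h]; exact Nat.lt_succ_iff.1 (Finset.mem_range.1 hm), h⟩

/-- **`Σ_{n ≤ N} P_p(0 ↔ ∂Λ_n, |C(0)| < ∞) ≤ Σ_{x ∈ Λ_N} τᶠ_p(0,x)`** (every `p`, `N`). [folklore] -/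
theorem sum_range_real_finiteArm_le_sum_box (p : unitInterval) (N : ℕ) :
    ∑ n ∈ Finset.range (N + 1), (bondPercolation (zdGraph 3) p).real (siteToBoundary 3 n \ percolatesAt 0) ≤
      ∑ x ∈ box 3 N, (bondPercolation (zdGraph 3) p).real (openConn 0 x \ percolatesAt 0) := by
  rw [sum_box_eq_sum_range_sum_sphere]
  exact Finset.sum_le_sum fun n _ => real_finiteArm_le_sum_sphere p n

/-- **`χᶠ(p) < ∞ ⇒ Σ_n P_p(0 ↔ ∂Λ_n, |C(0)| < ∞) < ∞`** (every `p`): bounded partial sums of a nonnegative series. [folklore] -/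
theorem summable_real_finiteArm_of_truncatedSusceptibility (p : unitInterval)
    (hchi : Summable fun x : Site 3 => (bondPercolation (zdGraph 3) p).real (openConn 0 x \ percolatesAt 0)) :
    Summable fun n : ℕ => (bondPercolation (zdGraph 3) p).real (siteToBoundary 3 n \ percolatesAt 0) := by
  refine summable_of_sum_range_le (c := ∑' x : Site 3, (bondPercolation (zdGraph 3) p).real (openConn 0 x \ percolatesAt 0))
    (fun n => measureReal_nonneg) fun N => ?_
  calc ∑ n ∈ Finset.range N, (bondPercolation (zdGraph 3) p).real (siteToBoundary 3 n \ percolatesAt 0)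
      ≤ ∑ n ∈ Finset.range (N + 1), (bondPercolation (zdGraph 3) p).real (siteToBoundary 3 n \ percolatesAt 0) :=
        Finset.sum_le_sum_of_subset_of_nonneg (Finset.range_mono N.le_succ) fun _ _ _ => measureReal_nonneg
    _ ≤ ∑ x ∈ box 3 N, (bondPercolation (zdGraph 3) p).real (openConn 0 x \ percolatesAt 0) :=
        sum_range_real_finiteArm_le_sum_box p N
    _ ≤ ∑' x : Site 3, (bondPercolation (zdGraph 3) p).real (openConn 0 x \ percolatesAt 0) :=
        hchi.sum_le_tsum _ fun x _ => measureReal_nonneg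

/-! ## §2 Summable blocking from `χᶠ < ∞` at a percolating `p` -/

/-- **`θ(p) > 0` and `χᶠ(p) < ∞` force `Σ_n u_n(p) < ∞`** (every `p`): `u_n θ ≤ P(E_n)` (radius quarantine sandwich) and
`Σ_n P(E_n) ≤ χᶠ`. For `p > p_c` both hypotheses are theorems and so is the conclusion; the content is at a percolating `p_c`.
[folklore] -/
theorem summable_blockProb_of_truncatedSusceptibility (p : unitInterval)
    (hθ : 0 < theta (zdGraph 3) (0 : Site 3) p)
    (hchi : Summable fun x : Site 3 => (bondPercolation (zdGraph 3) p).real (openConn 0 x \ percolatesAt 0)) :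
    Summable fun n : ℕ => blockProb 3 p n := by
  have hE := summable_real_finiteArm_of_truncatedSusceptibility p hchi
  have hprod : Summable fun n : ℕ => blockProb 3 p n * theta (zdGraph 3) (0 : Site 3) p :=
    hE.of_nonneg_of_le (fun n => mul_nonneg (blockProb_nonneg 3 p n) hθ.le) fun n => blockProb_mul_theta_le p n
  have h := hprod.mul_right (theta (zdGraph 3) (0 : Site 3) p)⁻¹
  refine h.congr fun n => ?_
  field_simp

/-- **Registered sub-goal `stub_summable_blocking_of_truncatedSusceptibility`** (the `p_c` instance, blocking event spelled
as in crux `SubpolynomialBlocking`): `χᶠ(p_c) < ∞ ⇒ θ(p_c) > 0 ⇒ Σ_n u_n(p_c) < ∞`. [folklore] -/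
theorem stub_summable_blocking_of_truncatedSusceptibility : (Summable fun x : Site 3 => (bondPercolation (zdGraph 3) (criticalProbI 3)).real (openConn 0 x \ percolatesAt 0)) → 0 < theta (zdGraph 3) (0 : Site 3) (criticalProbI 3) → Summable fun n : ℕ => (bondPercolation (zdGraph 3) (criticalProbI 3)).real {ω | ¬ ∃ x ∈ box 3 n, ∃ y ∈ innerBoundary (zdGraph 3) (box 3 (2 * n)), ω ∈ openConnIn ↑(box 3 (2 * n)) x y} := by
  intro hchi hθ
  exact summable_blockProb_of_truncatedSusceptibility (criticalProbI 3) hθ hchi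

/-! ## §3 Certificate: the crux is the summit modulo non-summable critical blocking -/

/-- **`Σ_n u_n(p_c) = ∞ ⇒ (TruncatedSusceptibilityFiniteOfTheta ↔ PercolationContinuityZ3)`.**
(⇐) `TruncatedSusceptibilityFiniteOfTheta_of_percolationContinuity` (p153838); (⇒) in a jump world the crux gives
`χᶠ(p_c) < ∞`, whence summable blocking (`summable_blockProb_of_truncatedSusceptibility`), contradiction. So every proof of
crux 0852 short of `θ(p_c) = 0` lives in the world "critical annulus blocking is summable". [folklore] -/
theorem TruncatedSusceptibilityFiniteOfTheta_iff_summit_of_not_summable_blocking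
    (hU : ¬ Summable fun n : ℕ => blockProb 3 (criticalProbI 3) n) :
    Summit.CriticalPhenomena.PercolationContinuityZ3.Theses.PercNecklaceBackbone.TruncatedSusceptibilityFiniteOfTheta ↔
      _root_.PercolationContinuityZ3 := by
  constructor
  · intro hL
    show theta (zdGraph 3) (0 : Site 3) (criticalProbI 3) = 0
    by_contra hθ
    have hθpos : 0 < theta (zdGraph 3) (0 : Site 3) (criticalProbI 3) :=
      lt_of_le_of_ne measureReal_nonneg (Ne.symm hθ)
    exact hU (summable_blockProb_of_truncatedSusceptibility (criticalProbI 3) hθpos (hL (criticalProbI 3) hθpos))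
  · intro hcont
    exact TruncatedSusceptibilityFiniteOfTheta_of_percolationContinuity hcont

/-- Home-route spelling (`PercTruncatedSusceptibility`; shared item, identical text). [folklore] -/
theorem TruncatedSusceptibilityFiniteOfTheta_iff_summit_of_not_summable_blocking'
    (hU : ¬ Summable fun n : ℕ => blockProb 3 (criticalProbI 3) n) :
    Summit.CriticalPhenomena.PercolationContinuityZ3.Theses.PercTruncatedSusceptibility.TruncatedSusceptibilityFiniteOfTheta ↔
      _root_.PercolationContinuityZ3 :=
  TruncatedSusceptibilityFiniteOfTheta_iff_summit_of_not_summable_blocking hU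

/-- **The two blocking certificates combined**: if critical annulus blocking is EITHER not summable OR not `O(1/n)`, crux 0852
is equivalent to the conjunct `θ(p_c) = 0`. [folklore] -/
theorem TruncatedSusceptibilityFiniteOfTheta_iff_summit_of_blocking_large
    (hU : (¬ Summable fun n : ℕ => blockProb 3 (criticalProbI 3) n) ∨
      ¬ ∃ C : ℝ, ∀ n : ℕ, blockProb 3 (criticalProbI 3) n ≤ C / ((n : ℝ) + 1)) :
    Summit.CriticalPhenomena.PercolationContinuityZ3.Theses.PercNecklaceBackbone.TruncatedSusceptibilityFiniteOfTheta ↔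
      _root_.PercolationContinuityZ3 :=
  hU.elim TruncatedSusceptibilityFiniteOfTheta_iff_summit_of_not_summable_blocking
    TruncatedSusceptibilityFiniteOfTheta_iff_summit_of_blocking

end Summit.CriticalPhenomena.PercolationContinuityZ3.Theorems.TruncatedSusceptibilityFiniteOfTheta

end
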